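import Mathlib
import HarnessLib

/-!
# LINE (A) `product_plus_one` — puller moments and the function `Ψ = S₁ + S₂/S₁` (definitions only)

Objects of the ONE-RISER INTERACTION LEMMA (memo `NOTE-p7g15-18050-LINEA-incoherent-cell.md` §9, crux item
stmt-ValiantsHypothesis-18050, LINE (A) floor structure).  A cloud of binomial "pullers" `a_i − b_i Y` (`a_i, b_i > 0`) with zeros
`z_i = a_i/b_i` and weights `m_i > 0` contributes `−Y·S₁(Y)` to the total Euler ratio, where

* `momentS s m z k Y = Σ_{i ∈ s} m_i/(z_i − Y)^k` is the `k`-th puller moment (`S_k`);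
* `psiFun s m z Y = S₁ + S₂/S₁` (`Ψ`) is the function whose logarithmic derivative `Y·Ψ′/Ψ` controls the number of zeros;
* `psiDeriv` (`Ψ′ = S₂ + (2S₁S₃ − S₂²)/S₁²`) and `psiDeriv2` (`Ψ″`) are its first two derivatives, written out as closed forms in the
  moments (that they ARE the derivatives below every pole is proved in `…ProductPlusOneOneRiserCalculus`).

Plain `noncomputable def`s of real-valued functions; no structure, no instance, no notation, no named fact, no axiom.
Honest framing: definitions only — nothing here counts zeros; `OneChangeFloorK3` / the four stubs / 18050 / `MatrixDescartes` OPEN;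
`VP ≠ VNP` NOT proved.
-/

set_option linter.dupNamespace false

namespace Summit.ValiantsHypothesis.ValiantsHypothesis.Theorems.LacunarySymmetroidMatrixDescartes

namespace ProductPlusOne

open Finset
open scoped BigOperators

variable {ι : Type*} (s : Finset ι) (m z : ι → ℝ)

/-- The `k`-th **puller moment** `S_k(Y) = Σ_{i ∈ s} m_i/(z_i − Y)^k` of a cloud with weights `m_i` and poles `z_i`. -/
noncomputable def momentS (k : ℕ) (Y : ℝ) : ℝ := ∑ i ∈ s, m i / (z i - Y) ^ k

/-- `Ψ(Y) = S₁(Y) + S₂(Y)/S₁(Y)`. -/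
noncomputable def psiFun (Y : ℝ) : ℝ := momentS s m z 1 Y + momentS s m z 2 Y / momentS s m z 1 Y

/-- The closed form of `Ψ′`: `S₂ + (2 S₁ S₃ − S₂²)/S₁²`. -/
noncomputable def psiDeriv (Y : ℝ) : ℝ :=
  momentS s m z 2 Y + (2 * momentS s m z 1 Y * momentS s m z 3 Y - momentS s m z 2 Y ^ 2) / momentS s m z 1 Y ^ 2

/-- The closed form of `Ψ″`: `2S₃ + (6 S₁ S₄ − 2 S₂ S₃)/S₁² − 2 S₂ (2 S₁ S₃ − S₂²)/S₁³`. -/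
noncomputable def psiDeriv2 (Y : ℝ) : ℝ :=
  2 * momentS s m z 3 Y + (6 * momentS s m z 1 Y * momentS s m z 4 Y - 2 * momentS s m z 2 Y * momentS s m z 3 Y) / momentS s m z 1 Y ^ 2
    - 2 * momentS s m z 2 Y * (2 * momentS s m z 1 Y * momentS s m z 3 Y - momentS s m z 2 Y ^ 2) / momentS s m z 1 Y ^ 3

/-- Unfolding lemma: `momentS` is the displayed sum. -/
theorem momentS_def (k : ℕ) (Y : ℝ) : momentS s m z k Y = ∑ i ∈ s, m i / (z i - Y) ^ k := rfl

/-- Unfolding lemma: `psiFun = S₁ + S₂/S₁`. -/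
theorem psiFun_def (Y : ℝ) : psiFun s m z Y = momentS s m z 1 Y + momentS s m z 2 Y / momentS s m z 1 Y := rfl

end ProductPlusOne

end Summit.ValiantsHypothesis.ValiantsHypothesis.Theorems.LacunarySymmetroidMatrixDescartes
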